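import Mathlib.Algebra.Module.LinearMap.Rat
import Mathlib.FieldTheory.Fixed
import Mathlib.FieldTheory.Galois.Basic
import Mathlib.GroupTheory.Index
import Literature.FieldTheory.AlgClosed.AutFixedSubfield
import HarnessLib

/-!
# A subgroup of `Aut(ℂ)` of finite index in `Aut(ℂ/E)`, `E` a number field, has a fixed field
# finite over `ℚ`

Topic `FieldTheory/AlgClosed`; theorems only (no definitions, no named facts), a sequel of
`AutFixedSubfield.lean` ("the fixed field of `Aut(ℂ/F)` is `F`" for countable `F ⊆ ℂ`) and
`AutComplexClosedSubgroups.lean`.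

For the transcendental extension `ℂ/ℚ` the fixed field of a subgroup `H ≤ Aut(ℂ) = (ℂ ≃ₐ[ℚ] ℂ)`
is in general not finite over `ℚ` even for large `H`. What descent arguments over number fields
use (Clozel 1990, proof of Thm. 3.13 (i): the set `{^σπ_f : σ ∈ Aut(ℂ/E)}` of conjugates of a
cohomological `π_f` is FINITE, hence the stabiliser `{σ : ^σπ_f ≅ π_f}` has finite index in
`Aut(ℂ/E)` and its fixed field `ℚ(π_f)` is a number field; Shimura 1971, §6.8, Prop. 6.28 ff.
for the same use of `Aut(ℂ)`) is:

* `Complex.finiteDimensional_fixedField_of_finiteIndex` — if `H ∩ Aut(ℂ/E)` has finite index in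
  `Aut(ℂ/E)` for a subfield `E ⊆ ℂ` finite over `ℚ`, then `Fix(H)` is finite over `ℚ`.

Proof: let `N ⊴ Aut(ℂ/E)` be the normal core of `H ∩ Aut(ℂ/E)` (still of finite index) and
`L = Fix(N) ⊇ Fix(H)`. Then `Aut(ℂ/E)` acts on `L` through the finite group
`Γ = Aut(ℂ/E)/N`, and `L^Γ = Fix(Aut(ℂ/E)) = E` because `E` is countable
(`Complex.mem_subfield_of_forall_ringEquiv`). By Artin's theorem (Mathlib
`FixedPoints.finrank_le_card`: `[L : L^Γ] ≤ |Γ|`) `L` is finite over `E`, hence over `ℚ`, and so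
is `Fix(H) ⊆ L`. (Lang, *Algebra*, Ch. VI §1, Thm. 1.8.)

## References

* S. Lang, *Algebra*, rev. 3rd ed., GTM 211, Springer 2002, Ch. VI §1 (Thm. 1.8, Artin). [Lang2002]
* L. Clozel, *Motifs et formes automorphes: applications du principe de fonctorialité*, in
  Automorphic forms, Shimura varieties, and L-functions I (Ann Arbor 1988), Academic Press 1990,
  §3.1 and Thm. 3.13 (i). [Clozel1990]
-/

noncomputable section

open IntermediateField
open scoped Classical Cardinal

namespace Literature.FieldTheory.AlgClosed

/-- **`Fix(Aut(ℂ/E)) = E` for `E ⊆ ℂ` finite over `ℚ`**, in the language of `ℚ`-algebra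
automorphisms: an element of `ℂ` fixed by every `σ ∈ Aut(ℂ)` fixing the intermediate field `E`
pointwise lies in `E` (`E` is countable; `Complex.mem_subfield_of_forall_ringEquiv`).
[cite: Lang2002, Ch. VIII §1] -/
theorem Complex.mem_of_forall_mem_fixingSubgroup (E : IntermediateField ℚ ℂ) [FiniteDimensional ℚ E]
    {z : ℂ} (h : ∀ σ ∈ E.fixingSubgroup, σ z = z) : z ∈ E := by
  haveI : Algebra.IsAlgebraic ℚ E.toSubfield := Algebra.IsAlgebraic.of_finite ℚ E
  have hc : #E.toSubfield ≤ ℵ₀ := Subfield.cardinalMk_le_aleph0_of_isAlgebraic E.toSubfield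
  refine Complex.mem_subfield_of_forall_ringEquiv E.toSubfield hc fun σ hσ ↦ ?_
  let σ' : ℂ ≃ₐ[ℚ] ℂ := AlgEquiv.ofRingEquiv (f := σ) fun q ↦ by simp
  exact h σ' ((mem_fixingSubgroup_iff _ _).mpr fun x hx ↦ hσ x hx)

/-- **A subgroup of `Aut(ℂ)` of finite index inside `Aut(ℂ/E)`, `E ⊆ ℂ` finite over `ℚ`, has a
fixed field finite over `ℚ`.** If `H ≤ Aut(ℂ) = (ℂ ≃ₐ[ℚ] ℂ)` and `H ∩ Aut(ℂ/E)` has finite index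
in `Aut(ℂ/E)` (e.g. `Aut(ℂ/E)` permutes a finite set on which `H ∩ Aut(ℂ/E)` is a stabiliser),
then `Fix(H)` is finite-dimensional over `ℚ`. With `N ⊴ Aut(ℂ/E)` the normal core of
`H ∩ Aut(ℂ/E)`, the finite group `Aut(ℂ/E)/N` acts on `L = Fix(N) ⊇ Fix(H)` with fixed field
`E` (`Complex.mem_of_forall_mem_fixingSubgroup`), so `[L : E] ≤ |Aut(ℂ/E)/N|` by Artin's theorem
(Mathlib `FixedPoints`). This is the field theory behind "`{^σπ_f : σ ∈ Aut(ℂ/E)}` finite ⟹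
`ℚ(π_f)` is a number field" (Clozel 1990, proof of Thm. 3.13 (i)). [cite: Lang2002, Ch. VI §1, Thm. 1.8] -/
theorem Complex.finiteDimensional_fixedField_of_finiteIndex (H : Subgroup (ℂ ≃ₐ[ℚ] ℂ))
    (E : IntermediateField ℚ ℂ) [FiniteDimensional ℚ E]
    (hfin : ((H ⊓ E.fixingSubgroup).subgroupOf E.fixingSubgroup).FiniteIndex) :
    FiniteDimensional ℚ (fixedField H) := by
  -- the normal core `N ⊴ G = Aut(ℂ/E)` of `H ∩ G`, of finite index in `G`
  set G : Subgroup (ℂ ≃ₐ[ℚ] ℂ) := E.fixingSubgroup with hG_def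
  set N : Subgroup G := ((H ⊓ G).subgroupOf G).normalCore with hN_def
  haveI hNfi : N.FiniteIndex := Subgroup.finiteIndex_normalCore _
  haveI hNnormal : N.Normal := Subgroup.normalCore_normal _
  -- `L = Fix(N)`
  set L : IntermediateField ℚ ℂ := fixedField (N.map G.subtype) with hL_def
  have hNH : N.map G.subtype ≤ H := by
    intro σ hσ
    obtain ⟨τ, hτ, rfl⟩ := Subgroup.mem_map.mp hσ
    have h1 : τ ∈ (H ⊓ G).subgroupOf G := Subgroup.normalCore_le _ hτ
    exact (Subgroup.mem_subgroupOf.mp h1).1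
  have hHL : fixedField H ≤ L := fun z hz ↦
    (mem_fixedField_iff _ z).mpr fun σ hσ ↦ (mem_fixedField_iff H z).mp hz σ (hNH hσ)
  -- it suffices that `L` is finite over `ℚ`
  suffices hL : FiniteDimensional ℚ L from
    Module.Finite.of_injective (IntermediateField.inclusion hHL).toLinearMap
      (IntermediateField.inclusion_injective hHL)
  -- `G` acts on `L` (as `N` is normal in `G`), through `G/N`
  have hGL : ∀ (g : G) (z : ℂ), z ∈ L → (g : ℂ ≃ₐ[ℚ] ℂ) z ∈ L := by
    intro g z hz
    rw [hL_def, mem_fixedField_iff]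
    intro σ hσ
    obtain ⟨τ, hτ, rfl⟩ := Subgroup.mem_map.mp hσ
    have hconj : g⁻¹ * τ * g ∈ N := hNnormal.conj_mem' τ hτ g
    have hz' := (mem_fixedField_iff _ z).mp hz _ (Subgroup.mem_map_of_mem G.subtype hconj)
    -- `hz' : (g⁻¹ τ g) z = z`
    have e : (G.subtype (g⁻¹ * τ * g)) z =
        (g : ℂ ≃ₐ[ℚ] ℂ).symm ((τ : ℂ ≃ₐ[ℚ] ℂ) ((g : ℂ ≃ₐ[ℚ] ℂ) z)) := rfl
    rw [e] at hz'
    have h3 := congrArg (g : ℂ ≃ₐ[ℚ] ℂ) hz'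
    rw [AlgEquiv.apply_symm_apply] at h3
    exact h3
  -- the restriction homomorphism `G →* (L ≃ₐ[ℚ] L)`
  let resFun : G → (L ≃ₐ[ℚ] L) := fun g ↦
    { toFun := fun z ↦ ⟨(g : ℂ ≃ₐ[ℚ] ℂ) z, hGL g z z.2⟩
      invFun := fun z ↦ ⟨((g⁻¹ : G) : ℂ ≃ₐ[ℚ] ℂ) z, hGL g⁻¹ z z.2⟩
      left_inv := fun z ↦ Subtype.ext (by simp)
      right_inv := fun z ↦ Subtype.ext (by simp)
      map_mul' := fun z w ↦ Subtype.ext (map_mul _ _ _)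
      map_add' := fun z w ↦ Subtype.ext (map_add _ _ _)
      commutes' := fun q ↦ Subtype.ext ((g : ℂ ≃ₐ[ℚ] ℂ).commutes q) }
  have hresFun : ∀ (g : G) (z : L), ((resFun g z : L) : ℂ) = (g : ℂ ≃ₐ[ℚ] ℂ) z := fun _ _ ↦ rfl
  let res : G →* (L ≃ₐ[ℚ] L) :=
    { toFun := resFun
      map_one' := AlgEquiv.ext fun z ↦ Subtype.ext rfl
      map_mul' := fun g g' ↦ AlgEquiv.ext fun z ↦ Subtype.ext rfl }
  have hres : ∀ (g : G) (z : L), ((res g z : L) : ℂ) = (g : ℂ ≃ₐ[ℚ] ℂ) z := fun _ _ ↦ rfl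
  -- `N ≤ ker res`, so the image `Γ = res(G)` is finite
  have hNker : N ≤ res.ker := by
    intro τ hτ
    rw [MonoidHom.mem_ker]
    refine AlgEquiv.ext fun z ↦ Subtype.ext ?_
    rw [hres]
    exact (mem_fixedField_iff _ (z : ℂ)).mp z.2 _ (Subgroup.mem_map_of_mem G.subtype hτ)
  haveI : res.ker.FiniteIndex := Subgroup.finiteIndex_of_le hNker
  haveI : Finite (G ⧸ res.ker) := Subgroup.finite_quotient_of_finiteIndex
  haveI hΓ : Finite res.range :=
    Finite.of_equiv _ (QuotientGroup.quotientKerEquivRange res).toEquiv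
  -- Artin: `L` is finite over the fixed field `L^Γ`
  set F₀ : Subfield L := FixedPoints.subfield res.range L with hF₀_def
  haveI hLF₀ : FiniteDimensional F₀ L := inferInstance
  -- `L^Γ ⊆ E`, so `L^Γ` is finite over `ℚ`
  have hF₀E : ∀ z : L, z ∈ F₀ → (z : ℂ) ∈ E := by
    intro z hz
    refine Complex.mem_of_forall_mem_fixingSubgroup E fun σ hσ ↦ ?_
    have h1 := hz ⟨res ⟨σ, hσ⟩, ⟨⟨σ, hσ⟩, rfl⟩⟩
    -- `h1 : (res σ) • z = z`
    have h2 := congrArg (fun w : L ↦ (w : ℂ)) h1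
    exact h2
  let ι : F₀ →+ E :=
    { toFun := fun z ↦ ⟨((z : L) : ℂ), hF₀E z z.2⟩
      map_zero' := rfl
      map_add' := fun _ _ ↦ rfl }
  have hι : Function.Injective ι := fun z w h ↦
    Subtype.ext (Subtype.ext (congrArg (fun e : E ↦ (e : ℂ)) h :))
  haveI hF₀ : Module.Finite ℚ F₀ := Module.Finite.of_injective ι.toRatLinearMap hι
  haveI : IsScalarTower ℚ F₀ L := IsScalarTower.of_algebraMap_eq fun q ↦ by
    rw [eq_ratCast, eq_ratCast, map_ratCast]
  exact Module.Finite.trans F₀ L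

end Literature.FieldTheory.AlgClosed
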